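import Summits.PneNP.PneNP.Theses.RootDecompAccTransfer
import Literature.Computability.Complexity.KannanLanguage
import Literature.Computability.Complexity.SigmaDepth

/-!
# `RootDecompAccTransfer.FixedSizeRung` (stmt-PneNP-23747) — Kannan's fixed-polynomial rung inside Algorithmica

Node N4 of the decomp-pnenp root-decomposition cell (route `route-PneNP-RootDecompAccTransfer`) records,
as an aside, the decided cell just below its transfer piece on the class dial: for every `k`, if
`NP ⊆ P` then `P ⊄ ⋃_c SIZE(c·nᵏ + c)` — the SAT algorithm designs a P-language hard for fixed-polynomial
size (Kannan 1982: a `Σ₄ᵖ` language outside `SIZE(c·nᵏ + c)`, collapsed into `P`).  Both ingredients are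
tree theorems: `Kannan.exists_mem_SigmaP_four_not_mem_SIZE` (`KannanLanguage`) and
`SigmaP_subset_P_of_NP_subset_P` (`SigmaDepth`, p765627).  Port of the lens-2 g10 kernel
`fixedSizeRung_holds` (ExchangeRate.lean 535f3e44: the column statement `b = ∞` of the exchange-rate
square), certified closable by the cell critic 2026-08-30T08:26:46Z.  0 sorry.
-/

namespace Summit.PneNP.PneNP.Theorems

/-- `FixedSizeRung` (stmt-PneNP-23747): `∀ k, NP ⊆ P → ¬ (P ⊆ ⋃ c, SIZE (c·nᵏ + c))`, from Kannan's
`Σ₄ᵖ` language outside `⋃ c SIZE(c·nᵏ + c)` and the collapse `NP ⊆ P ⇒ Σ₄ᵖ ⊆ P` (tree theorems;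
decomp-pnenp cell, port of lens-2 g10 `fixedSizeRung_holds`, 2026-08-30). -/
theorem fixedSizeRung_proof :
    Summit.PneNP.PneNP.Theses.RootDecompAccTransfer.FixedSizeRung := by
  unfold Summit.PneNP.PneNP.Theses.RootDecompAccTransfer.FixedSizeRung
  intro k hNP hP
  obtain ⟨L, hL4, hLs⟩ :=
    Literature.Computability.Complexity.Kannan.exists_mem_SigmaP_four_not_mem_SIZE k
  exact hLs (hP (Literature.Computability.Complexity.SigmaP_subset_P_of_NP_subset_P hNP 4 hL4))

end Summit.PneNP.PneNP.Theorems
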